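import Mathlib
import HarnessLib
import Literature.AlgebraicGeometry.HyperbolicPolynomials.SpectrahedralShadow
import Summits.ValiantsHypothesis.ValiantsHypothesis.Theorems.PermanentalConesHyperbolicVPShadowStubRealifyHermitianPencil
import Summits.ValiantsHypothesis.ValiantsHypothesis.Theorems.PermanentalConesHyperbolicVPShadowStubSpectrahedronOfSymmDetPower

/-!
# ValiantsHypothesis / PermanentalCones — `HyperbolicVPShadow`, stub O₂

Route `PermanentalCones`, item `stmt-ValiantsHypothesis-8655` (crux `HyperbolicVPShadow`), line
`birth`, stub `stub_oshimeFamily2_spectrahedron`.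

Oshime's family (2) of non-symmetrisable linear pencils of real `3 × 3` matrices with only real
eigenvalues (Oshime 1991, Thm 4.7) is `P(x) = x₀ A + x₁ B + x₂ C` with
`A = diag(1, 0, 0)`, `B = !![0, α, 0; α, 1, 0; 0, 0, -1]`, `C = !![0, β, γ; β', 0, 1; γ', 1, 0]`,
`α > 0`, `D := 2αγ − α² − β² > 0`, `D' := 2αγ' − α² − β'² > 0`. We show that its closed
nonnegative-spectrum cone `{x : ∀ τ > 0, det (P x + τ·1) ≠ 0}` is a lifted-LMI set of size `6`.

## Proof

There is a *Hermitian* determinantal certificate: with `s := β + β'`, `δ := (β − β')/2`,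
`σ := (γ + γ')/2`, `ρ := (γ − γ')/2` there are real numbers `m, u, q` with
`m² = αu − δ²`, `mq = su/2 − ρδ`, `q² = u(2σ − α − u) − ρ²`
(`permanentalCones_oshime2_certificate`: `m = (√D + √D')/2`, `u = (m² + δ²)/α`,
`q = (su/2 − ρδ)/m`, the third relation reducing to the fact that `u` is a root of the quadratic
`α u² − B_q u + C_q` of discriminant `D·D'`). For the Hermitian matrix
`S₃ := !![0, s/2 + m i, p + q i; s/2 − m i, 0, 1; p − q i, 1, 0]`, `p := σ − u`, one has
`det (t·1 + x₀ A + x₁ B + x₂ S₃) = det (t·1 + x₀ A + x₁ B + x₂ C)` identically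
(`permanentalCones_oshime2_detIdentity`, a polynomial identity modulo the three relations).
Realifying the Hermitian pencil (`stub_realify_hermitianPencil`) gives a real symmetric pencil
`L` of size `2·3` with `det (L x + τ·1) = det (P x + τ·1)²`, and
`stub_spectrahedron_of_symmDetPower` (`k = 2`) turns this into a size-`6` lifted-LMI description
of the cone. No definitions are introduced: all matrices are literals, the two pencils are
`Fintype.linearCombination ℝ ![…]`.
-/

-- `<Problem> = <Summit>` for this single-conjunct summit (lakefile sets the same option tree-wide).
set_option linter.dupNamespace false

namespace Summit.ValiantsHypothesis.ValiantsHypothesis.Theorems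

open Matrix Complex

/-- **Parameters of the Hermitian certificate for Oshime's family (2).** If `α > 0`,
`2αγ − α² − β² > 0` and `2αγ' − α² − β'² > 0`, then there are real `m, u, q` with
`m² = αu − δ²`, `mq = (β + β')u/2 − ρδ` and `q² = u(γ + γ' − α − u) − ρ²`, where
`δ = (β − β')/2`, `ρ = (γ − γ')/2` (certificate for Oshime 1991, Thm 4.7, family (2)). [folklore] -/
theorem permanentalCones_oshime2_certificate (α β β' γ γ' : ℝ) (hα : 0 < α)
    (hD : 0 < 2 * α * γ - α ^ 2 - β ^ 2) (hD' : 0 < 2 * α * γ' - α ^ 2 - β' ^ 2) :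
    ∃ m u q : ℝ,
      m ^ 2 = α * u - ((β - β') / 2) ^ 2 ∧
      m * q = (β + β') * u / 2 - ((γ - γ') / 2) * ((β - β') / 2) ∧
      q ^ 2 = u * (γ + γ' - α - u) - ((γ - γ') / 2) ^ 2 := by
  obtain ⟨a, ha0, ha⟩ : ∃ a : ℝ, 0 < a ∧ a ^ 2 = 2 * α * γ - α ^ 2 - β ^ 2 :=
    ⟨Real.sqrt _, Real.sqrt_pos.2 hD, Real.sq_sqrt hD.le⟩
  obtain ⟨b, hb0, hb⟩ : ∃ b : ℝ, 0 < b ∧ b ^ 2 = 2 * α * γ' - α ^ 2 - β' ^ 2 :=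
    ⟨Real.sqrt _, Real.sqrt_pos.2 hD', Real.sq_sqrt hD'.le⟩
  -- the parameters `m`, `u`, `q` as fresh variables with their defining equations
  obtain ⟨m, hm⟩ : ∃ m : ℝ, m = (a + b) / 2 := ⟨_, rfl⟩
  obtain ⟨u, hu⟩ : ∃ u : ℝ, u = (m ^ 2 + ((β - β') / 2) ^ 2) / α := ⟨_, rfl⟩
  obtain ⟨q, hq⟩ : ∃ q : ℝ,
      q = ((β + β') * u / 2 - ((γ - γ') / 2) * ((β - β') / 2)) / m := ⟨_, rfl⟩
  have hα0 : α ≠ 0 := hα.ne'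
  have hm0 : m ≠ 0 := by rw [hm]; positivity
  have R1 : m ^ 2 = α * u - ((β - β') / 2) ^ 2 := by
    rw [hu]; field_simp; ring
  have R2 : m * q = (β + β') * u / 2 - ((γ - γ') / 2) * ((β - β') / 2) := by
    rw [hq]; field_simp
  refine ⟨m, u, q, R1, R2, ?_⟩
  -- `u` is a root of the quadratic `α u² - B_q u + C_q`, whose discriminant is `D D' = (a b)²`
  have h2u : 2 * α * u = (α * (γ + γ') - α ^ 2 + ((β - β') / 2) ^ 2 - (β + β') ^ 2 / 4)
      + a * b := by
    have : 2 * α * u = 2 * (m ^ 2 + ((β - β') / 2) ^ 2) := by rw [hu]; field_simp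
    rw [this, hm]
    linear_combination (1 / 2 : ℝ) * ha + (1 / 2 : ℝ) * hb
  have hquad : α * u ^ 2 - (α * (γ + γ') - α ^ 2 + ((β - β') / 2) ^ 2 - (β + β') ^ 2 / 4) * u
      + (α * ((γ - γ') / 2) ^ 2 + 2 * ((β - β') / 2) ^ 2 * ((γ + γ') / 2)
        - α * ((β - β') / 2) ^ 2 - (β + β') * ((γ - γ') / 2) * ((β - β') / 2)) = 0 := by
    have h4 : (4 * α) * (α * u ^ 2
        - (α * (γ + γ') - α ^ 2 + ((β - β') / 2) ^ 2 - (β + β') ^ 2 / 4) * u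
        + (α * ((γ - γ') / 2) ^ 2 + 2 * ((β - β') / 2) ^ 2 * ((γ + γ') / 2)
          - α * ((β - β') / 2) ^ 2 - (β + β') * ((γ - γ') / 2) * ((β - β') / 2))) = 0 := by
      linear_combination ((2 * α * u) - (α * (γ + γ') - α ^ 2 + ((β - β') / 2) ^ 2
        - (β + β') ^ 2 / 4) + a * b) * h2u
        + (2 * α * γ' - α ^ 2 - β' ^ 2) * ha + a ^ 2 * hb
    have h4α : (4 * α) ≠ 0 := by positivity
    exact (mul_eq_zero.1 h4).resolve_left h4α
  -- multiply the claimed relation by `m² ≠ 0` and use `R1`, `R2`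
  have key : m ^ 2 * (q ^ 2 - (u * (γ + γ' - α - u) - ((γ - γ') / 2) ^ 2)) = 0 := by
    have : m ^ 2 * (q ^ 2 - (u * (γ + γ' - α - u) - ((γ - γ') / 2) ^ 2)) =
        (m * q) ^ 2 - m ^ 2 * (u * (γ + γ' - α - u) - ((γ - γ') / 2) ^ 2) := by ring
    rw [this, R2, R1]
    linear_combination u * hquad
  have := (mul_eq_zero.1 key).resolve_left (pow_ne_zero 2 hm0)
  linarith

/-- **The Hermitian determinantal identity for Oshime's family (2).** Under the three relations
of `permanentalCones_oshime2_certificate` (with `b₀ = (β + β')/2`, `p₀ = (γ + γ')/2 − u`),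
`det (t·1 + x₀ A + x₁ B + x₂ S₃) = det (t·1 + x₀ A + x₁ B + x₂ C)` for the Hermitian matrix
`S₃ = !![0, b₀ + m i, p₀ + q i; b₀ − m i, 0, 1; p₀ − q i, 1, 0]`, both sides written out as
explicit `3 × 3` matrices (Oshime 1991, Thm 4.7, family (2)). [folklore] -/
theorem permanentalCones_oshime2_detIdentity (α β β' γ γ' m u q b₀ p₀ : ℝ)
    (hb₀ : b₀ = (β + β') / 2) (hp₀ : p₀ = (γ + γ') / 2 - u)
    (R1 : m ^ 2 = α * u - ((β - β') / 2) ^ 2)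
    (R2 : m * q = (β + β') * u / 2 - ((γ - γ') / 2) * ((β - β') / 2))
    (R3 : q ^ 2 = u * (γ + γ' - α - u) - ((γ - γ') / 2) ^ 2) (t x₀ x₁ x₂ : ℝ) :
    (!![(t : ℂ) + x₀, α * x₁ + x₂ * (b₀ + m * I), x₂ * (p₀ + q * I);
        α * x₁ + x₂ * (b₀ - m * I), t + x₁, x₂;
        x₂ * (p₀ - q * I), x₂, t - x₁]).det =
      ((!![t + x₀, α * x₁ + β * x₂, γ * x₂; α * x₁ + β' * x₂, t + x₁, x₂;
          γ' * x₂, x₂, t - x₁]).det : ℂ) := by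
  subst hb₀ hp₀
  have R1c : (m : ℂ) ^ 2 = α * u - ((β - β') / 2) ^ 2 := by exact_mod_cast R1
  have R2c : (m : ℂ) * q = (β + β') * u / 2 - ((γ - γ') / 2) * ((β - β') / 2) := by
    exact_mod_cast R2
  have R3c : (q : ℂ) ^ 2 = u * (γ + γ' - α - u) - ((γ - γ') / 2) ^ 2 := by exact_mod_cast R3
  simp only [Matrix.det_fin_three, Matrix.of_apply, Matrix.cons_val', Matrix.cons_val_zero,
    Matrix.cons_val_one, Matrix.cons_val_two, Matrix.head_cons, Matrix.tail_cons,
    Matrix.empty_val', Matrix.cons_val_fin_one, Matrix.head_fin_const]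
  push_cast
  -- the two cofactor expansions differ by `ρ₁ (x₁ - t) x₂² - ρ₃ (t + x₁) x₂² + 2 ρ₂ x₂³`, where
  -- `ρ₁, ρ₂, ρ₃` are the defects of the three relations, plus a multiple of `I² + 1`
  linear_combination ((x₁ : ℂ) - t) * x₂ ^ 2 * R1c - ((t : ℂ) + x₁) * x₂ ^ 2 * R3c
    + 2 * (x₂ : ℂ) ^ 3 * R2c
    + ((m : ℂ) ^ 2 * x₂ ^ 2 * (t - x₁) - 2 * m * q * x₂ ^ 3 + q ^ 2 * x₂ ^ 2 * (t + x₁)) * I_sq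

/-- **Stub (Oshime's family (2) has size-`6` spectrahedral cones).** For `α > 0`,
`2αγ − α² − β² > 0`, `2αγ' − α² − β'² > 0`, the closed nonnegative-spectrum cone
`{x : ∀ τ > 0, det (x₀ A + x₁ B + x₂ C + τ·1) ≠ 0}` of the real-spectrum pencil
`A = diag(1,0,0)`, `B = !![0, α, 0; α, 1, 0; 0, 0, -1]`, `C = !![0, β, γ; β', 0, 1; γ', 1, 0]`
(Oshime 1991, Thm 4.7, family (2)) is a lifted-LMI set of size `6`: a Hermitian `3 × 3`
determinantal representation, realified to a symmetric `6 × 6` representation of the square of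
`det (P x + τ·1)`. [folklore] -/
theorem stub_oshimeFamily2_spectrahedron :
    ∀ α β β' γ γ' : ℝ, 0 < α → 0 < 2 * α * γ - α ^ 2 - β ^ 2 → 0 < 2 * α * γ' - α ^ 2 - β' ^ 2 →
      Literature.AlgebraicGeometry.HyperbolicPolynomials.IsSpectrahedralShadowOfSize
        {x : Fin 3 → ℝ | ∀ τ : ℝ, 0 < τ →
          (x 0 • !![(1 : ℝ), 0, 0; 0, 0, 0; 0, 0, 0] + x 1 • !![0, α, 0; α, 1, 0; 0, 0, -1] +
            x 2 • !![0, β, γ; β', 0, 1; γ', 1, 0] + τ • (1 : Matrix (Fin 3) (Fin 3) ℝ)).det ≠ 0} 6 := by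
  intro α β β' γ γ' hα hD hD'
  obtain ⟨m, u, q, R1, R2, R3⟩ := permanentalCones_oshime2_certificate α β β' γ γ' hα hD hD'
  obtain ⟨b₀, hb₀⟩ : ∃ b₀ : ℝ, b₀ = (β + β') / 2 := ⟨_, rfl⟩
  obtain ⟨p₀, hp₀⟩ : ∃ p₀ : ℝ, p₀ = (γ + γ') / 2 - u := ⟨_, rfl⟩
  -- the real pencil `P x = x 0 • A + x 1 • B + x 2 • C`
  let P : (Fin 3 → ℝ) →ₗ[ℝ] Matrix (Fin 3) (Fin 3) ℝ := Fintype.linearCombination ℝ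
    ![!![(1 : ℝ), 0, 0; 0, 0, 0; 0, 0, 0], !![0, α, 0; α, 1, 0; 0, 0, -1],
      !![0, β, γ; β', 0, 1; γ', 1, 0]]
  have hP : ∀ x : Fin 3 → ℝ, P x = x 0 • !![(1 : ℝ), 0, 0; 0, 0, 0; 0, 0, 0] +
      x 1 • !![0, α, 0; α, 1, 0; 0, 0, -1] + x 2 • !![0, β, γ; β', 0, 1; γ', 1, 0] := fun x => by
    simp only [P, Fintype.linearCombination_apply, Fin.sum_univ_three, Matrix.cons_val_zero,
      Matrix.cons_val_one, Matrix.cons_val_two, Matrix.head_cons, Matrix.tail_cons]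
  have hPx : ∀ (x : Fin 3 → ℝ) (τ : ℝ), P x + τ • (1 : Matrix (Fin 3) (Fin 3) ℝ) =
      !![τ + x 0, α * x 1 + β * x 2, γ * x 2; α * x 1 + β' * x 2, τ + x 1, x 2;
        γ' * x 2, x 2, τ - x 1] := fun x τ => by
    rw [hP]
    ext i j
    fin_cases i <;> fin_cases j <;> simp <;> ring
  -- the Hermitian pencil `H x = x 0 • A + x 1 • B + x 2 • S₃`
  let Aℂ : Matrix (Fin 3) (Fin 3) ℂ := !![1, 0, 0; 0, 0, 0; 0, 0, 0]
  let Bℂ : Matrix (Fin 3) (Fin 3) ℂ := !![0, (α : ℂ), 0; (α : ℂ), 1, 0; 0, 0, -1]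
  let S₃ : Matrix (Fin 3) (Fin 3) ℂ :=
    !![0, (b₀ : ℂ) + m * I, (p₀ : ℂ) + q * I; (b₀ : ℂ) - m * I, 0, 1; (p₀ : ℂ) - q * I, 1, 0]
  have hAh : Aℂ.IsHermitian := Matrix.IsHermitian.ext fun i j => by
    fin_cases i <;> fin_cases j <;> simp [Aℂ]
  have hBh : Bℂ.IsHermitian := Matrix.IsHermitian.ext fun i j => by
    fin_cases i <;> fin_cases j <;> simp [Bℂ]
  have hSh : S₃.IsHermitian := Matrix.IsHermitian.ext fun i j => by
    fin_cases i <;> fin_cases j <;> simp [S₃, Complex.ext_iff]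
  let H : (Fin 3 → ℝ) →ₗ[ℝ] Matrix (Fin 3) (Fin 3) ℂ := Fintype.linearCombination ℝ ![Aℂ, Bℂ, S₃]
  have hH : ∀ x : Fin 3 → ℝ, H x = x 0 • Aℂ + x 1 • Bℂ + x 2 • S₃ := fun x => by
    simp only [H, Fintype.linearCombination_apply, Fin.sum_univ_three, Matrix.cons_val_zero,
      Matrix.cons_val_one, Matrix.cons_val_two, Matrix.head_cons, Matrix.tail_cons]
  have hHerm : ∀ x : Fin 3 → ℝ, (H x).IsHermitian := fun x => by
    rw [hH]
    exact ((hAh.smul (IsSelfAdjoint.all _)).add (hBh.smul (IsSelfAdjoint.all _))).add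
      (hSh.smul (IsSelfAdjoint.all _))
  have hHx : ∀ (x : Fin 3 → ℝ) (τ : ℝ), H x + (τ : ℂ) • (1 : Matrix (Fin 3) (Fin 3) ℂ) =
      !![(τ : ℂ) + x 0, α * x 1 + x 2 * (b₀ + m * I), x 2 * (p₀ + q * I);
        α * x 1 + x 2 * (b₀ - m * I), τ + x 1, x 2;
        x 2 * (p₀ - q * I), x 2, τ - x 1] := fun x τ => by
    rw [hH]
    ext i j
    fin_cases i <;> fin_cases j <;> simp [Aℂ, Bℂ, S₃, Matrix.smul_apply] <;> ring
  -- the determinantal identity `det (H x + τ·1) = det (P x + τ·1)`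
  have hdet : ∀ (x : Fin 3 → ℝ) (τ : ℝ), (H x + (τ : ℂ) • (1 : Matrix (Fin 3) (Fin 3) ℂ)).det =
      (((P x + τ • (1 : Matrix (Fin 3) (Fin 3) ℝ)).det : ℝ) : ℂ) := fun x τ => by
    rw [hHx, hPx]
    exact permanentalCones_oshime2_detIdentity α β β' γ γ' m u q b₀ p₀ hb₀ hp₀ R1 R2 R3 τ (x 0)
      (x 1) (x 2)
  -- realification: a symmetric pencil of size `2·3` representing the square of `det (P x + τ·1)`
  obtain ⟨L, hLsymm, hLdet⟩ := stub_realify_hermitianPencil 3 3 H hHerm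
  have hLdet' : ∀ (x : Fin 3 → ℝ) (τ : ℝ),
      (L x + τ • (1 : Matrix (Fin (2 * 3)) (Fin (2 * 3)) ℝ)).det =
        ((P x + τ • (1 : Matrix (Fin 3) (Fin 3) ℝ)).det) ^ 2 := fun x τ => by
    have h := hLdet x τ
    simp only [Complex.coe_algebraMap] at h
    have hs : star (((P x + τ • (1 : Matrix (Fin 3) (Fin 3) ℝ)).det : ℝ) : ℂ) =
        ((P x + τ • (1 : Matrix (Fin 3) (Fin 3) ℝ)).det : ℝ) := Complex.conj_ofReal _
    rw [hdet x τ, hs, ← Complex.ofReal_mul] at h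
    rw [sq]
    exact_mod_cast h
  have h6 := stub_spectrahedron_of_symmDetPower 3 3 (2 * 3) 2 P L two_ne_zero hLsymm hLdet'
  simp only [hP] at h6
  exact h6

end Summit.ValiantsHypothesis.ValiantsHypothesis.Theorems
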